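import Literature.AnabelianGeometry.SemiGraphs.TemperedPiExistence
import Literature.AnabelianGeometry.SemiGraphs.CoveringComponent
import Literature.AnabelianGeometry.SemiGraphs.SplitsLemmas

/-!
# The levels of the Galois tower split every tempered component ([SemiAnbd] Prop. 3.6, p. 38) — proofs

Proof-only file.  For `𝒢` satisfying the hypotheses of Prop. 3.6 and a tempered covering `T`, every
connected component of `T` is split (globally, as the object `T.component p`) by the levels
`S i` of the Galois tower from some `i` on: temperedness gives a finite `F` splitting the component,
Galois-countability gives a member of the countable family splitting `F`, the tower dominates that
member, and splitting is transitive and inherited by dominating coverings (`SplitsLemmas.lean`).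
This is the cofinality statement of [SemiAnbd] p. 38 ("cofinal among all connected finite étale
coverings") in the form needed for the universal property of the `𝒢_{∞,i}`.
-/

namespace Literature.AnabelianGeometry.SemiGraphs

namespace ProfiniteSemiGraph

open CategoryTheory CategoryTheory.PreGaloisCategory Literature.AnabelianGeometry.Anabelioids
open scoped FintypeCatDiscrete

universe u

variable (𝒢 : ProfiniteSemiGraph.{u}) (h36 : 𝒢.Prop36Hypotheses)

/-- The tower level `S i` dominates the `i`-th member of the Galois-countability family.
[cite: MochizukiSemiAnbd2006, Prop 3.6 p.38] -/
theorem exists_hom_level_gcFamily (i : ℕ) :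
    Nonempty ((𝒢.galoisLevelData h36).S i ⟶ h36.isGaloisCountable.2.choose i) := by
  letI := SemiGraphOfAnabelioids.galoisCategory_bObj 𝒢.toAnab ⟨h36.isConnected⟩
  haveI := 𝒢.fiberFunctor_fiberAt h36.isConnected (𝒢.baseVertex h36)
  exact ⟨𝒢.ofBObj.map (galoisTowerToX (𝒢.fiberAt (𝒢.baseVertex h36))
      (𝒢.gcFamily h36.isGaloisCountable)
      (𝒢.nonempty_fiberAt_gcFamily h36.isGaloisCountable (𝒢.baseVertex h36)) i) ≫
    (ofBObjIso (h36.isGaloisCountable.2.choose i) (h36.isGaloisCountable.2.choose_spec.1 i).1).hom⟩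

/-- Higher levels dominate lower ones. [cite: MochizukiSemiAnbd2006, Prop 3.6 p.38] -/
theorem exists_hom_level_le {i j : ℕ} (hij : i ≤ j) :
    Nonempty ((𝒢.galoisLevelData h36).S j ⟶ (𝒢.galoisLevelData h36).S i) := by
  induction j, hij using Nat.le_induction with
  | base => exact ⟨𝟙 _⟩
  | succ k hk ih =>
    obtain ⟨f⟩ := ih
    exact ⟨(𝒢.galoisLevelData h36).g k ≫ f⟩

/-- **Every component of a tempered covering is split by the tower levels from some level on.**
[cite: MochizukiSemiAnbd2006, Prop 3.6 p.38] -/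
theorem exists_level_splits_component (T : CovObj 𝒢) (hT : T.IsTempered) (p : T.Point) :
    ∃ i : ℕ, ∀ j, i ≤ j → ((𝒢.galoisLevelData h36).S j).Splits (T.component p) := by
  obtain ⟨F, hfin, hne, hsplit⟩ := T.exists_splits_component p hT
  obtain ⟨i, hi⟩ := h36.isGaloisCountable.2.choose_spec.2 F hfin
  refine ⟨i, fun j hij => ?_⟩
  obtain ⟨f⟩ := 𝒢.exists_hom_level_le h36 hij
  obtain ⟨g⟩ := 𝒢.exists_hom_level_gcFamily h36 i
  have h1 : ((𝒢.galoisLevelData h36).S j).Splits F := CovObj.Splits.of_hom (f ≫ g) hi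
  exact CovObj.Splits.trans h1 hne hsplit

end ProfiniteSemiGraph

end Literature.AnabelianGeometry.SemiGraphs
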